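import Summits.HubbardSuperconductivity.HubbardSuperconductivity.Theorems.TwTipContinuation.Negative.AbstractTipShapeFalse

/-!
# Crux `PbContinuation` (stmt-HubbardSuperconductivity-0907; = `LevyLogBootstrap.Continuation`,
# `AnisotropyChord.Continuation`, `PolyaSchurPairBoson.Continuation`) — the EVENTUAL-IN-VOLUME walk
# shape is false: a crossing point `t_L ↑ 1` defeats every fixed-`t'` hypothesis (negative-side
# support, cdisprove cycle 1)

The crux's anchor has the quantifier shape `∀ t' ∈ (0,t₀), ∃ c(t'), ∃ L₀(t'), ∀ L ≥ L₀(t'), …`: the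
threshold volume may depend on `t'`. Grant the prover EVERYTHING a "no phase transition at any fixed
`t' < 1`" theorem could give — every-GS order at EVERY `t < 1` (not only small `t`), with a
`t`-UNIFORM constant, UNIQUE ground states everywhere (so the degenerate-endpoint excuse of
`Negative/UniformWalkShapeFalse.lean` is gone) — but keep the threshold `L₀(t)` `t`-dependent, as in
the crux. This file records, sorry-free, that the endpoint can still be dark IN EVERY VOLUME: for the
volume-indexed affine families `A_L + tV_L = diag(0, t - 1 + 1/(L+1))`, `P = diag(0,1) ≥ 0`, each
fixed `t < 1` is lit (unique ground states `±e₁`, `⟨P⟩ = 1`) for all `L + 1 > 2/(1-t)`, while at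
`t = 1` the matrix `diag(0, 1/(L+1))` has the unique, dark ground states `±e₀` for EVERY `L`. The
crossing point `t_L = 1 - 1/(L+1)` runs into the endpoint as the volume grows — the finite-volume
shadow of a transition AT the uniform point, which no fixed-`t'` information excludes. This is the
exact content of the caveat in the landed `PbContinuation.exists_nhds_forall_groundState_order`
("what the crux needs and this cannot give is volume-uniformity of the neighbourhood"): the
every-GS strict bound is open in `t` at fixed volume, but the neighbourhoods need not contain a
common left neighbourhood of `1`. Together with `IdeationR1K2.not_abstractContinuationShape`
(crossing at a fixed `t < 1`) and `not_abstractUniformWalkShape` (degenerate endpoint) it closes the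
list of abstract escape routes: a proof of the crux must produce an `L`-UNIFORM left neighbourhood of
`t' = 1` on which the checkerboard Hubbard ground states stay ordered — i.e. model-specific control
at the uniform point itself.

* `not_abstractEventualWalkShape` — `¬ ∀ (A V : ℕ → Matrix (Fin 2) (Fin 2) ℝ) (P : Matrix (Fin 2)
  (Fin 2) ℝ), P.PosSemidef → (∀ t < 1, ∃ L₀, ∀ L ≥ L₀, every unit minimiser `v` of
  `⟨v,(A L + t V L)v⟩` has `1 ≤ ⟨v,Pv⟩`) → ∃ L₀, ∀ L ≥ L₀, every unit minimiser of
  `⟨v,(A L + V L)v⟩` has `0 < ⟨v,Pv⟩``.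

Elementary linear algebra; folklore. (`toy_norm`, `toy_formA` reused from
`TwTipContinuation.Negative.AbstractTipShapeFalse`.)
-/

namespace Summit.HubbardSuperconductivity.PbContinuation.Negative

open Matrix
open Summit.HubbardSuperconductivity.TwTipContinuation.Negative (toy_norm toy_formA)

/-- `⟨v, (A_L + tV) v⟩ = (t − 1 + 1/(L+1)) v₁²` for `A_L = diag(0, −1 + 1/(L+1))`, `V = diag(0,1)`.
[folklore] -/
theorem eventualToy_form (L : ℕ) (t : ℝ) (v : Fin 2 → ℝ) :
    v ⬝ᵥ (Matrix.diagonal ![(0 : ℝ), -1 + 1 / ((L : ℝ) + 1)] + t • Matrix.diagonal ![(0 : ℝ), 1]) *ᵥ v =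
      (t - 1 + 1 / ((L : ℝ) + 1)) * v 1 ^ 2 := by
  simp [Matrix.mulVec, dotProduct, Fin.sum_univ_two, Matrix.diagonal, Matrix.add_apply]
  ring

/-- At the endpoint: `⟨v, (A_L + V) v⟩ = v₁²/(L+1)`. [folklore] -/
theorem eventualToy_form_one (L : ℕ) (v : Fin 2 → ℝ) :
    v ⬝ᵥ (Matrix.diagonal ![(0 : ℝ), -1 + 1 / ((L : ℝ) + 1)] + Matrix.diagonal ![(0 : ℝ), 1]) *ᵥ v =
      (1 / ((L : ℝ) + 1)) * v 1 ^ 2 := by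
  simp [Matrix.mulVec, dotProduct, Fin.sum_univ_two, Matrix.diagonal, Matrix.add_apply]
  ring

/-- **The eventual-in-volume walk shape is FALSE** (crossing point `t_L = 1 - 1/(L+1) ↑ 1`): with
`A_L = diag(0, -1 + 1/(L+1))`, `V_L = diag(0,1)`, `P = diag(0,1) ≥ 0`, every fixed `t < 1` is lit —
unique unit ground states `±e₁` with `⟨P⟩ = 1` — in all volumes `L + 1 > 2/(1-t)`, yet at `t = 1`
the unique ground states `±e₀` of `diag(0, 1/(L+1))` are dark in EVERY volume. Hence even "every-GS
order at every `t' < 1`, eventually in `L` with a `t'`-dependent threshold" (far more than the crux's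
anchor) does not give order at `t' = 1` in any volume by bookkeeping: an `L`-uniform left
neighbourhood of the uniform point is the irreducible model-specific input. [folklore] -/
theorem not_abstractEventualWalkShape :
    ¬ (∀ (A V : ℕ → Matrix (Fin 2) (Fin 2) ℝ) (P : Matrix (Fin 2) (Fin 2) ℝ), P.PosSemidef →
        (∀ t : ℝ, t < 1 → ∃ L₀ : ℕ, ∀ L : ℕ, L₀ ≤ L → ∀ v : Fin 2 → ℝ,
          (v ⬝ᵥ v = 1 ∧ ∀ w : Fin 2 → ℝ, w ⬝ᵥ w = 1 →
              v ⬝ᵥ (A L + t • V L) *ᵥ v ≤ w ⬝ᵥ (A L + t • V L) *ᵥ w) → 1 ≤ v ⬝ᵥ P *ᵥ v) →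
        ∃ L₀ : ℕ, ∀ L : ℕ, L₀ ≤ L → ∀ v : Fin 2 → ℝ,
          (v ⬝ᵥ v = 1 ∧ ∀ w : Fin 2 → ℝ, w ⬝ᵥ w = 1 →
              v ⬝ᵥ (A L + V L) *ᵥ v ≤ w ⬝ᵥ (A L + V L) *ᵥ w) → 0 < v ⬝ᵥ P *ᵥ v) := by
  intro h
  set A : ℕ → Matrix (Fin 2) (Fin 2) ℝ :=
    fun L => Matrix.diagonal ![(0 : ℝ), -1 + 1 / ((L : ℝ) + 1)] with hA
  set V : ℕ → Matrix (Fin 2) (Fin 2) ℝ := fun _ => Matrix.diagonal ![(0 : ℝ), 1] with hV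
  have hP : (Matrix.diagonal ![(0 : ℝ), 1]).PosSemidef :=
    Matrix.PosSemidef.diagonal (by intro i; fin_cases i <;> simp)
  -- lit at every fixed `t < 1`, eventually in the volume (threshold `⌈2/(1-t)⌉`)
  have hlit : ∀ t : ℝ, t < 1 → ∃ L₀ : ℕ, ∀ L : ℕ, L₀ ≤ L → ∀ v : Fin 2 → ℝ,
      (v ⬝ᵥ v = 1 ∧ ∀ w : Fin 2 → ℝ, w ⬝ᵥ w = 1 →
          v ⬝ᵥ (A L + t • V L) *ᵥ v ≤ w ⬝ᵥ (A L + t • V L) *ᵥ w) →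
        1 ≤ v ⬝ᵥ Matrix.diagonal ![(0 : ℝ), 1] *ᵥ v := by
    intro t ht
    refine ⟨⌈2 / (1 - t)⌉₊, ?_⟩
    rintro L hL v ⟨hn, hmin⟩
    have h1t : 0 < 1 - t := by linarith
    have hceil : 2 / (1 - t) ≤ (L : ℝ) := (Nat.le_ceil _).trans (by exact_mod_cast hL)
    have hL1 : 0 < (L : ℝ) + 1 := by positivity
    -- `1/(L+1) < (1-t)/2`, hence the `e₁`-coefficient is negative
    have hinv : 1 / ((L : ℝ) + 1) < 1 - t := by
      rw [div_lt_iff₀ hL1]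
      have h2 : 2 ≤ (1 - t) * (L : ℝ) := by
        have := (div_le_iff₀ h1t).1 hceil
        linarith
      nlinarith
    have hcoef : t - 1 + ((L : ℝ) + 1)⁻¹ < 0 := by rw [← one_div]; linarith
    have h1 := hmin ![0, 1] (by simp [dotProduct, Fin.sum_univ_two])
    rw [hA, hV, eventualToy_form, eventualToy_form] at h1
    rw [toy_norm] at hn
    rw [toy_formA]
    simp at h1
    -- h1 : c * v 1 ^ 2 ≤ c with c < 0 ⇒ v 1 ^ 2 ≥ 1
    by_contra hc
    push Not at hc
    have h2 := mul_lt_mul_of_neg_left hc hcoef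
    rw [mul_one] at h2
    linarith
  obtain ⟨L₀, hL₀⟩ := h A V _ hP hlit
  -- dark at the endpoint in EVERY volume: `e₀` is a ground state of `diag(0, 1/(L+1))`, `⟨P⟩ = 0`
  have hgs : (![1, 0] : Fin 2 → ℝ) ⬝ᵥ ![1, 0] = 1 ∧ ∀ w : Fin 2 → ℝ, w ⬝ᵥ w = 1 →
      ![1, 0] ⬝ᵥ (A L₀ + V L₀) *ᵥ ![1, 0] ≤ w ⬝ᵥ (A L₀ + V L₀) *ᵥ w := by
    refine ⟨by simp [dotProduct, Fin.sum_univ_two], fun w _ => ?_⟩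
    rw [hA, hV, eventualToy_form_one, eventualToy_form_one]
    simp
    positivity
  have := hL₀ L₀ le_rfl ![1, 0] hgs
  rw [toy_formA] at this
  simp at this

end Summit.HubbardSuperconductivity.PbContinuation.Negative
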